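import Literature.Algebra.Homology.ExtOfProjectiveResolution
import Literature.Algebra.Homology.GroupCohomologyResolutionComparison
import Literature.Algebra.Homology.DiscreteRepEnoughInjectives
import HarnessLib

/-!
# `Extⁿ_{Rep k G}(k, A) ≃+ Hⁿ(G, A)`: Mathlib's derived-category `Ext` from the trivial representation
# in `Rep k G` IS Mathlib's group cohomology (any group `G`, any commutative ring `k`)

Topic `Algebra/Homology`; namespace `Literature.Algebra.Homology.RepExt`.  Definitions with bodies and
theorems; no named fact, no `sorry`; one instance (`HasExt (Rep k G)`, a `Prop`-valued smallness
statement, from the tree's `EnoughInjectives (Rep k G)`).  Sequel of `ExtOfProjectiveResolution`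
(door-c4 g14: `Extⁿ(X, Y) ≃+ Hⁿ(Ext⁰(P•, Y))` for an exact augmented chain complex with
`Ext(–, Y)`-acyclic terms) and of the tree's `GroupCohomologyResolutionComparison`
(`ResolutionComparison.resolutionIso P A n : groupCohomology A n ≅ Hⁿ(Hom(P•, A))` for ANY projective
resolution `P` of the trivial representation, natural in `A`).

Mathlib identifies `groupCohomology A n` with `Ext` only for the OLDER, projective-resolution `Ext`
functor `CategoryTheory.Ext R C n` (`groupCohomologyIsoExt`); the class-field-theory files of the tree
(Route A of the Poitou–Tate programme: `ExtOfAcyclicResolution`, `DiscreteRep*`, `ExtDualityPairing`,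
`TateNakayama*`) use the NEWER `CategoryTheory.Abelian.Ext` (derived category, `HasExt`, long exact
sequences, Yoneda composition).  This file closes that gap:

* instance `hasExt : HasExt.{u} (Rep.{u} k G)`;
* `homComplexIso P A : LeftResolution.homComplex P.complex A ≅ Hom(P•, A)` (Mathlib's
  `P.complex.linearYonedaObj k A` viewed in `AddCommGrpCat`) and `homComplexHomologyIso`;
* **`extTrivialAddEquivResolutionHomology P A n : Ext (Rep.trivial k G k) A n ≃+ Hⁿ(Hom(P•, A))`**
  for every projective resolution `P` of `k` (the engine, `Ext.eq_zero_of_projective`,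
  `ProjectiveResolution.exact₀ / complex_exactAt_succ`);
* **`extTrivialAddEquivGroupCohomology A n : Ext (Rep.trivial k G k) A n ≃+ groupCohomology A n`**
  (through Mathlib's standard resolution and `resolutionIso`) — Brown, *Cohomology of Groups*,
  III §1 "`H*(G, M) = Ext*_{ℤG}(ℤ, M)`", for Mathlib's two models.

Written for the Poitou–Tate programme of crux `stmt-BirchSwinnertonDyer-19295` (cell
`bsd-schneider-ideate`, seat door-c4 gen 14): the finite-layer results of the cell (class modules,
fundamental classes, Tate–Nakayama, idèle-class vanishing) live in Mathlib's `groupCohomology` of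
`Rep ℤ Gal(E/F)`, while the profinite assembly (`H^r(Γ_K, C̄) = lim→ H^r(Gal(E/K), C_E)`, Milne I
Lemma 1.9, Harari Thm. 16.21) runs in `Abelian.Ext`; this is the dictionary between the two.
Not here: naturality in `A` and compatibility with the long exact sequences / with inflation
(sequel).  HONEST FRAMING: homological algebra only.

## References
* K. S. Brown, *Cohomology of Groups*, GTM 87 (1982), III §1 (definition of `H*(G, M)` as `Ext`,
  computed from any projective resolution). [Brown1982CohomologyGroups]
* C. A. Weibel, *An introduction to homological algebra* (1994), §2.4–§2.5, Thm. 2.7.6, §6.1.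
  [Weibel1994]
-/

noncomputable section

universe u

namespace Literature.Algebra.Homology

namespace RepExt

open CategoryTheory CategoryTheory.Limits CategoryTheory.Abelian

variable {k G : Type u} [CommRing k] [Group G]

/-- **`Rep k G` has `Ext`-groups in universe `u`** (Mathlib's `Abelian.Ext`; from the tree's instance
`EnoughInjectives (Rep k G)`, transported from `ModuleCat k[G]`). [cite: Weibel1994, §2.5] -/
instance hasExt : HasExt.{u} (Rep.{u} k G) := hasExt_of_enoughInjectives.{u} (Rep.{u} k G)

/-! ## §1 `Ext⁰(P•, A)` is Mathlib's `Hom(P•, A)` -/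

section HomComplex

variable (P : ChainComplex (Rep.{u} k G) ℕ) (A : Rep.{u} k G)

variable (k) in
/-- The forgetful functor `ModuleCat k ⥤ AddCommGrpCat`. [folklore] -/
abbrev forgetAb : ModuleCat.{u} k ⥤ AddCommGrpCat.{u} := forget₂ (ModuleCat.{u} k) AddCommGrpCat.{u}

/-- `Ext⁰`-bookkeeping: `addEquiv₀ (mk₀ f ∘ x) = f ≫ addEquiv₀ x`. [cite: Weibel1994, §2.7] -/
theorem addEquiv₀_mk₀_comp {X Y : Rep.{u} k G} (f : X ⟶ Y) (x : Ext Y A 0) :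
    Ext.addEquiv₀ ((Ext.mk₀ f).comp x (zero_add 0)) = f ≫ Ext.addEquiv₀ x := by
  apply Ext.addEquiv₀.symm.injective
  rw [AddEquiv.symm_apply_apply, Ext.addEquiv₀_symm_apply, ← Ext.mk₀_comp_mk₀,
    Ext.mk₀_addEquiv₀_apply]

/-- **`Ext⁰(P•, A) ≅ Hom(P•, A)`** as cochain complexes of abelian groups: the engine's `homComplex`
(`n ↦ Ext⁰(Pₙ, A)`, precomposition with `d`) versus Mathlib's `P.linearYonedaObj k A` viewed in
`AddCommGrpCat`, via `Ext.addEquiv₀` termwise. [cite: Brown1982CohomologyGroups, III §1] -/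
def homComplexIso :
    LeftResolution.homComplex P A ≅
      ((forgetAb k).mapHomologicalComplex (ComplexShape.up ℕ)).obj (P.linearYonedaObj k A) :=
  HomologicalComplex.Hom.isoOfComponents
    (fun n => AddEquiv.toAddCommGrpIso (Ext.addEquiv₀ : Ext (P.X n) A 0 ≃+ (P.X n ⟶ A)))
    (fun i j hij => by
      obtain rfl : i + 1 = j := hij
      ext x
      change (forgetAb k).map ((P.linearYonedaObj k A).d i (i + 1))
          (Ext.addEquiv₀ x) = Ext.addEquiv₀ (((LeftResolution.homComplex P A).d i (i + 1)).hom x)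
      rw [LeftResolution.homComplex_d_apply, addEquiv₀_mk₀_comp]
      rfl)

/-- Hence **`Hⁿ(Ext⁰(P•, A)) ≅ Hⁿ(Hom(P•, A))`** (the latter computed in `ModuleCat k` and then
forgotten to `AddCommGrpCat`, which preserves homology). [cite: Brown1982CohomologyGroups, III §1] -/
def homComplexHomologyIso (n : ℕ) :
    (LeftResolution.homComplex P A).homology n ≅ (forgetAb k).obj ((P.linearYonedaObj k A).homology n) :=
  (HomologicalComplex.homologyFunctor _ _ n).mapIso (homComplexIso P A) ≪≫
    ((P.linearYonedaObj k A).sc n).mapHomologyIso (forgetAb k)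

end HomComplex

/-! ## §2 `Extⁿ(k, A) ≃+ Hⁿ(Hom(P•, A))` for a projective resolution `P` of `k` -/

section Resolution

variable (P : ProjectiveResolution (Rep.trivial k G k)) (A : Rep.{u} k G)

/-- The augmentation `P₀ → k` of a projective resolution, as a morphism to `Rep.trivial k G k`.
[cite: Weibel1994, §2.4] -/
abbrev aug : P.complex.X 0 ⟶ Rep.trivial k G k := P.π.f 0

/-- `d₁₀ ≫ ε = 0`. [cite: Weibel1994, §2.4] -/
theorem d_comp_aug : P.complex.d 1 0 ≫ aug P = 0 := P.complex_d_comp_π_f_zero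

/-- `P₁ → P₀ → k` is exact. [cite: Weibel1994, §2.4] -/
theorem exact_aug : (ShortComplex.mk (P.complex.d 1 0) (aug P) (d_comp_aug P)).Exact := P.exact₀

/-- The augmentation is an epimorphism. [cite: Weibel1994, §2.4] -/
theorem epi_aug : Epi (aug P) := inferInstanceAs (Epi (P.π.f 0))

/-- **`Extⁿ(k, A) ≃+ Hⁿ(Ext⁰(P•, A))`** (the engine `ExtOfProjectiveResolution` for the projective
resolution `P` of the trivial representation). [cite: Brown1982CohomologyGroups, III §1][cite: Weibel1994, Theorem 2.7.6] -/
def extTrivialAddEquivHomComplexHomology (n : ℕ) :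
    Ext (Rep.trivial k G k) A n ≃+ ((LeftResolution.homComplex P.complex A).homology n : AddCommGrpCat.{u}) :=
  haveI := epi_aug P
  match n with
  | 0 => LeftResolution.extAddEquivHomologyZero P.complex A (aug P) (d_comp_aug P) (exact_aug P)
  | n + 1 => LeftResolution.extAddEquivHomologySucc P.complex A (aug P) (d_comp_aug P) (exact_aug P)
      P.complex_exactAt_succ (LeftResolution.ext_eq_zero_of_projective P.complex A P.projective) n

/-- **`Extⁿ_{Rep k G}(k, A) ≃+ Hⁿ(Hom(P•, A))`** for every projective resolution `P` of the trivial
representation `k` (the right-hand side is Mathlib's `(P.complex.linearYonedaObj k A).homology n`).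
[cite: Brown1982CohomologyGroups, III §1][cite: Weibel1994, Theorem 2.7.6] -/
def extTrivialAddEquivResolutionHomology (n : ℕ) :
    Ext (Rep.trivial k G k) A n ≃+ (P.complex.linearYonedaObj k A).homology n :=
  (extTrivialAddEquivHomComplexHomology P A n).trans
    (homComplexHomologyIso P.complex A n).addCommGroupIsoToAddEquiv

end Resolution

/-! ## §3 `Extⁿ_{Rep k G}(k, A) ≃+ Hⁿ(G, A)` -/

/-- **`Extⁿ_{Rep k G}(k, A) ≃+ Hⁿ(G, A)`**: Mathlib's derived-category `Ext` from the trivial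
representation agrees with Mathlib's `groupCohomology` (inhomogeneous cochains), for every group `G`,
commutative ring `k` and representation `A` — through the standard resolution and the tree's
`ResolutionComparison.resolutionIso`. [cite: Brown1982CohomologyGroups, III §1] -/
def extTrivialAddEquivGroupCohomology (A : Rep.{u} k G) (n : ℕ) :
    Ext (Rep.trivial k G k) A n ≃+ groupCohomology A n :=
  (extTrivialAddEquivResolutionHomology (Rep.standardResolution k G) A n).trans
    ((forgetAb k).mapIso
      (ResolutionComparison.resolutionIso (Rep.standardResolution k G) A n)).addCommGroupIsoToAddEquiv.symm

/-- In particular `Hⁿ⁺¹(G, A) = 0` detects `Extⁿ⁺¹(k, A) = 0` and conversely: a vanishing criterion in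
the form used by the class-field-theory files. [cite: Brown1982CohomologyGroups, III §1] -/
theorem ext_trivial_eq_zero_of_isZero_groupCohomology (A : Rep.{u} k G) (n : ℕ)
    (h : IsZero (groupCohomology A n)) (x : Ext (Rep.trivial k G k) A n) : x = 0 := by
  apply (extTrivialAddEquivGroupCohomology A n).injective
  rw [map_zero]
  exact (ModuleCat.isZero_iff_subsingleton.1 h).elim _ _

end RepExt

end Literature.Algebra.Homology
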